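import Mathlib.Analysis.SpecialFunctions.Pow.Real
import Mathlib.Analysis.SpecialFunctions.Sqrt
import Literature.Probability.LatticeModels.ScalingLimit
import HarnessLib

/-!
# Pointwise scaling limits are unique up to one scale; renormalisation patches

Topic `Probability/LatticeModels`; family `crit-ising`. THEOREM-ONLY leaf file (no definitions, no
named facts) about the prelude notion `HasPointwiseScalingLimit G ρ S` (`ScalingLimit.lean`):

* `HasPointwiseScalingLimit.exists_scale` — if `S` (renormalisation `ρ > 0`) and `S'`
  (renormalisation `ρ' > 0`) are pointwise scaling limits of the SAME lattice family `G` and both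
  two-point functions are positive at ONE common non-coincident pair `x₀`, then there is a constant
  `c > 0` with `S' n = c^n · S n` on non-coincident configurations, for every `n`
  (`c = lim ρ'/ρ = (S'₂ x₀ / S₂ x₀)^{1/2}`). So the freedom in the renormalisation of a pointwise
  limit is a single positive scale; `exists_scale_of_isNondegenerateTwoPoint` is the form with
  `IsNondegenerateTwoPoint` (`d ≥ 1`).
* `limitConnectedFour_eq_pow_mul_of_scale`, `hasNontrivialU4_iff_of_scale` — consequently the
  connected four-point function scales by `c⁴` and `HasNontrivialU4` is renormalisation-independent.
* `HasPointwiseScalingLimit.of_eventuallyEq_renormalisation` — the limit only sees `ρ` near `0⁺`;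
  `HasPointwiseScalingLimit.exists_pos_renormalisation` — for a lattice family with vanishing odd
  correlators, a signed renormalisation that is eventually non-zero can be replaced by a strictly
  positive one with the same limit (even correlators see `|ρ|^n = ρ^n`).

These are the bookkeeping facts behind "clause (iii) (`U₄ ≢ 0`) of the conformal-limit problem does
not depend on `ρ`" (Chelkak–Hongler–Izyurov 2015 normalise by `ρ(δ) = δ^{-1/8}`; on `ℤ³` the exponent
is unknown and `ρ` is quantified). Elementary real analysis; no source beyond the definitions.

## References

* D. Chelkak, C. Hongler, K. Izyurov, Ann. Math. 181 (2015), Thm 1.1 [ChelkakHonglerIzyurov2015].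
-/

noncomputable section

open Filter Topology

namespace Literature.Probability.LatticeModels

variable {d : ℕ}

/-- A pair of distinct points is a non-coincident configuration. [folklore] -/
private theorem pair_mem_nonCoincident_aux {p q : EuclideanSpace ℝ (Fin d)} (h : p ≠ q) :
    (![p, q] : Fin 2 → EuclideanSpace ℝ (Fin d)) ∈ NonCoincident d 2 := by
  rw [mem_nonCoincident]
  intro i j hij
  fin_cases i <;> fin_cases j
  · rfl
  · exact absurd hij h
  · exact absurd hij.symm h
  · rfl

/-- **The pointwise limit only sees the renormalisation near `0⁺`**: if the rescaled correlators for
`ρ` and `ρ'` agree for all small `δ > 0`, they have the same pointwise scaling limits. [folklore] -/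
theorem HasPointwiseScalingLimit.of_eventuallyEq_renormalisation {G : LatticeCorrFamily d}
    {ρ ρ' : ℝ → ℝ} {S : CorrFamily d} (h : HasPointwiseScalingLimit G ρ S)
    (hev : ∀ᶠ δ in 𝓝[>] (0:ℝ), ∀ n (x : Fin n → EuclideanSpace ℝ (Fin d)),
      rescaledCorrelator G ρ n δ x = rescaledCorrelator G ρ' n δ x) :
    HasPointwiseScalingLimit G ρ' S := fun n =>
  (h n).congr_inseparable (hev.mono fun _ hδ x _ => Inseparable.of_eq (hδ n x))

/-- **Signed renormalisations can be made positive** when odd correlators vanish: if `G n ≡ 0` for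
odd `n` and `ρ` is eventually non-zero along `δ → 0⁺`, there is `ρ' > 0` (everywhere) with the same
pointwise scaling limit (`ρ' = |ρ|` off the zero set of `ρ`, `1` on it; even `n` see
`|ρ|^n = ρ^n`). [folklore] -/
theorem HasPointwiseScalingLimit.exists_pos_renormalisation {G : LatticeCorrFamily d}
    {ρ : ℝ → ℝ} {S : CorrFamily d} (h : HasPointwiseScalingLimit G ρ S)
    (hodd : ∀ n, Odd n → ∀ y : Fin n → Site d, G n y = 0) (hne : ∀ᶠ δ in 𝓝[>] (0:ℝ), ρ δ ≠ 0) :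
    ∃ ρ' : ℝ → ℝ, (∀ δ, 0 < ρ' δ) ∧ HasPointwiseScalingLimit G ρ' S := by
  classical
  refine ⟨fun δ => if ρ δ = 0 then 1 else |ρ δ|, fun δ => ?_, h.of_eventuallyEq_renormalisation ?_⟩
  · dsimp only
    split_ifs with h0
    · exact one_pos
    · exact abs_pos.2 h0
  · filter_upwards [hne] with δ hδ n x
    rw [rescaledCorrelator_apply, rescaledCorrelator_apply, if_neg hδ]
    rcases Nat.even_or_odd n with hn | hn
    · rw [hn.pow_abs]
    · rw [hodd n hn, mul_zero, mul_zero]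

/-- **Uniqueness of the pointwise scaling limit up to one scale.** Two pointwise scaling limits `S`
(renormalisation `ρ > 0` on `(0,1]`) and `S'` (renormalisation `ρ' > 0` on `(0,1]`) of the same lattice
family, with two-point functions positive at one common non-coincident pair `x₀`, satisfy
`S' n x = c^n S n x` for all `n` and all non-coincident `x`, where `c = (S'₂ x₀/S₂ x₀)^{1/2} > 0` is
the limit of `ρ'/ρ`. [folklore] -/
theorem HasPointwiseScalingLimit.exists_scale {G : LatticeCorrFamily d} {ρ ρ' : ℝ → ℝ}
    {S S' : CorrFamily d} (hρ : ∀ δ ∈ Set.Ioc (0:ℝ) 1, 0 < ρ δ) (hρ' : ∀ δ ∈ Set.Ioc (0:ℝ) 1, 0 < ρ' δ)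
    (hlim : HasPointwiseScalingLimit G ρ S) (hlim' : HasPointwiseScalingLimit G ρ' S')
    {x₀ : Fin 2 → EuclideanSpace ℝ (Fin d)} (hx₀ : x₀ ∈ NonCoincident d 2) (ha0 : 0 < S 2 x₀)
    (hb0 : 0 < S' 2 x₀) :
    ∃ c : ℝ, 0 < c ∧ ∀ n, ∀ x ∈ NonCoincident d n, S' n x = c ^ n * S n x := by
  set g : ℝ → ℝ := fun δ => G 2 (fun i => latticeApprox δ (x₀ i)) with hg
  have ha : Tendsto (fun δ => ρ δ ^ 2 * g δ) (𝓝[>] 0) (𝓝 (S 2 x₀)) := (hlim 2).tendsto_at hx₀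
  have hb : Tendsto (fun δ => ρ' δ ^ 2 * g δ) (𝓝[>] 0) (𝓝 (S' 2 x₀)) := (hlim' 2).tendsto_at hx₀
  have hIoc : Set.Ioc (0:ℝ) 1 ∈ 𝓝[>] (0:ℝ) := Ioc_mem_nhdsGT one_pos
  have hev : ∀ᶠ δ in 𝓝[>] (0:ℝ), δ ∈ Set.Ioc (0:ℝ) 1 ∧ 0 < ρ δ ^ 2 * g δ :=
    (Filter.eventually_of_mem hIoc fun δ hδ => hδ).and (ha.eventually_const_lt ha0)
  have hr2 : Tendsto (fun δ => (ρ' δ / ρ δ) ^ 2) (𝓝[>] 0) (𝓝 (S' 2 x₀ / S 2 x₀)) := by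
    have hq : Tendsto (fun δ => (ρ' δ ^ 2 * g δ) / (ρ δ ^ 2 * g δ)) (𝓝[>] 0)
        (𝓝 (S' 2 x₀ / S 2 x₀)) := hb.div ha ha0.ne'
    refine hq.congr' ?_
    filter_upwards [hev] with δ hδ
    have hg0 : g δ ≠ 0 := by
      intro h0; rw [h0, mul_zero] at hδ; exact lt_irrefl _ hδ.2
    rw [div_pow, mul_div_mul_right _ _ hg0]
  set c : ℝ := Real.sqrt (S' 2 x₀ / S 2 x₀) with hc
  have hcpos : 0 < c := Real.sqrt_pos.2 (div_pos hb0 ha0)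
  have hr : Tendsto (fun δ => ρ' δ / ρ δ) (𝓝[>] 0) (𝓝 c) := by
    refine hr2.sqrt.congr' ?_
    filter_upwards [hev] with δ hδ
    exact Real.sqrt_sq (div_pos (hρ' δ hδ.1) (hρ δ hδ.1)).le
  refine ⟨c, hcpos, fun n x hx => ?_⟩
  have h1 : Tendsto (fun δ => ρ' δ ^ n * G n (fun i => latticeApprox δ (x i)))
      (𝓝[>] 0) (𝓝 (S' n x)) := (hlim' n).tendsto_at hx
  have h2 : Tendsto (fun δ => (ρ' δ / ρ δ) ^ n * (ρ δ ^ n * G n (fun i => latticeApprox δ (x i))))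
      (𝓝[>] 0) (𝓝 (c ^ n * S n x)) := (hr.pow n).mul ((hlim n).tendsto_at hx)
  refine tendsto_nhds_unique h1 (h2.congr' ?_)
  filter_upwards [hev] with δ hδ
  have hρ0 : ρ δ ≠ 0 := (hρ δ hδ.1).ne'
  rw [div_pow, ← mul_assoc, div_mul_cancel₀ _ (pow_ne_zero n hρ0)]

/-- The form with `IsNondegenerateTwoPoint` on both sides (`d ≥ 1`, reference pair `(0, e₀)`):
two non-degenerate pointwise scaling limits of the same lattice family differ by `c^n`, `c > 0`. [folklore] -/
theorem HasPointwiseScalingLimit.exists_scale_of_isNondegenerateTwoPoint (hd : 0 < d)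
    {G : LatticeCorrFamily d} {ρ ρ' : ℝ → ℝ} {S S' : CorrFamily d}
    (hρ : ∀ δ ∈ Set.Ioc (0:ℝ) 1, 0 < ρ δ) (hρ' : ∀ δ ∈ Set.Ioc (0:ℝ) 1, 0 < ρ' δ)
    (hlim : HasPointwiseScalingLimit G ρ S) (hlim' : HasPointwiseScalingLimit G ρ' S')
    (hnd : IsNondegenerateTwoPoint S) (hnd' : IsNondegenerateTwoPoint S') :
    ∃ c : ℝ, 0 < c ∧ ∀ n, ∀ x ∈ NonCoincident d n, S' n x = c ^ n * S n x := by
  have hx₀ : (![0, EuclideanSpace.single (⟨0, hd⟩ : Fin d) (1:ℝ)] : Fin 2 → EuclideanSpace ℝ (Fin d))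
      ∈ NonCoincident d 2 := by
    refine pair_mem_nonCoincident_aux fun h => ?_
    have := congrArg (fun v : EuclideanSpace ℝ (Fin d) => v ⟨0, hd⟩) h
    simp at this
  exact hlim.exists_scale hρ hρ' hlim' hx₀ (hnd _ hx₀) (hnd' _ hx₀)

/-- **Scaling of the connected four-point function**: if `S' n = c^n S n` on non-coincident
configurations then `U₄^{S'} = c⁴ U₄^S` there. [folklore] -/
theorem limitConnectedFour_eq_pow_mul_of_scale {S S' : CorrFamily d} {c : ℝ}
    (h : ∀ n, ∀ x ∈ NonCoincident d n, S' n x = c ^ n * S n x)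
    {x : Fin 4 → EuclideanSpace ℝ (Fin d)} (hx : x ∈ NonCoincident d 4) :
    limitConnectedFour S' x = c ^ 4 * limitConnectedFour S x := by
  have hinj : Function.Injective x := hx
  have hp : ∀ i j, i ≠ j → S' 2 ![x i, x j] = c ^ 2 * S 2 ![x i, x j] := fun i j hij =>
    h 2 _ (pair_mem_nonCoincident_aux fun e => hij (hinj e))
  simp only [limitConnectedFour]
  rw [h 4 x hx, hp 0 1 (by decide), hp 2 3 (by decide), hp 0 2 (by decide), hp 1 3 (by decide),
    hp 0 3 (by decide), hp 1 2 (by decide)]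
  ring

/-- **`HasNontrivialU4` is renormalisation-independent**: families related by a non-zero scale have
non-trivial `U₄` simultaneously. [folklore] -/
theorem hasNontrivialU4_iff_of_scale {S S' : CorrFamily d} {c : ℝ} (hc : c ≠ 0)
    (h : ∀ n, ∀ x ∈ NonCoincident d n, S' n x = c ^ n * S n x) :
    HasNontrivialU4 S' ↔ HasNontrivialU4 S := by
  constructor
  · rintro ⟨x, hx, hne⟩
    refine ⟨x, hx, fun h0 => hne ?_⟩
    rw [limitConnectedFour_eq_pow_mul_of_scale h hx, h0, mul_zero]
  · rintro ⟨x, hx, hne⟩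
    refine ⟨x, hx, fun h0 => hne ?_⟩
    rw [limitConnectedFour_eq_pow_mul_of_scale h hx] at h0
    exact (mul_eq_zero.1 h0).resolve_left (pow_ne_zero 4 hc)

end Literature.Probability.LatticeModels

end
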